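import Summits.AtomisticToContinuum.FouriersLaw.Theses.ContactStieltjesMeasure
import Summits.AtomisticToContinuum.FouriersLaw.Theses.BoundaryEscapeDeficit
import Summits.AtomisticToContinuum.FouriersLaw.Theses.OddSectorIrreversibility
import Summits.AtomisticToContinuum.FouriersLaw.Theorems.OddSectorIrreversibilityBoundedResponseConvergesEscapeDeficitForm
import Summits.AtomisticToContinuum.FouriersLaw.Theorems.EmbeddedDrudeMourreNessUnique
import Literature.MathematicalPhysics.KineticTheory.LangevinChainNESSHolds

/-!
# `ContactMeasureLimit` (crux stmt-AtomisticToContinuum-15250) — SPLIT GLUE and EXACTNESS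

Strategist file (`--supports stmt-AtomisticToContinuum-15250`, crux-strategist seat b1 on route
`ContactStieltjesMeasure`). The crux (M) of route `ContactStieltjesMeasure` says: for every family `Φ_N` of
contact distribution functions REPRESENTING the two-terminal response of `pinnedChain ω₂ lam β ·` at `T` and every
friction `γ`, `N·Φ_N(t) → M(t)` at the continuity points `t > 0` of a monotone `M`.

With weak-NESS uniqueness (`nessUnique_proof`), existence of steady states (`pinnedChain_exists_isSteadyState`) and
the response identity (`responseCoeff_eq_escapeDeficit`: every clause-(ii) response coefficient is the equilibrium
escape-deficit sequence `e_N = (N−1)·γ·E_N`) all LANDED, a representing family is pinned by the chain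
(`∫₀^∞ Φ_N k_γ = E_N(γ)`, `k_γ(t) = 2t/(γ²+t²)²`, `N ≥ 2`), and (M) splits EXACTLY into one analysis theorem and two
EXISTING items of sibling routes:

* `contactMeasureLimit_of_subs` — **`StieltjesContinuity → EscapeNonOscillation (12238) → BoundedResponse (10924) →
  ContactMeasureLimit`**, where `StieltjesContinuity` is the pure real-analysis continuity theorem for the contact
  kernel (spelled out as the first hypothesis; it is the registered stub `stub_stieltjesContinuity` of both lines
  `Lines/birth.lean` and `Lines/escape-import.lean` of the crux). Proof: along the canonical steady-state family,
  `D_N := (N−1)γ∫Φ_N k_γ` is a response coefficient, bounded by 10924, equal to `e_N` and hence `EReal`-convergent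
  by 12238, so convergent in `ℝ`; `N∫Φ_N k_γ = D_N·N/((N−1)γ)` converges at every `γ`; the continuity theorem does
  the rest.
* `escapeNonOscillation_of_contactStieltjes` — **`StieltjesRepresentation → ContactUpperDensity →
  ContactMeasureLimit → EscapeNonOscillation`**: granted the route's own K2 and (U), the crux gives back 12238 at
  EVERY friction (dominated convergence exactly as in the route's `closes`, then the response identity).
* `boundedResponse_of_contactStieltjes` — **`StieltjesRepresentation → ContactUpperDensity → BoundedResponse`**:
  the route's K2 ∧ (U) supply the sibling item 10924 at every friction (layer bound `∫Φ_N k_γ ≤ (C/N)∫(1+t)k_γ`).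

Hence on this route `StieltjesRepresentation ∧ ContactUpperDensity ∧ StieltjesContinuity ⊢ (ContactMeasureLimit ↔
EscapeNonOscillation)`: the crux carries no `N`-uniform content beyond item 12238 (the residual node of
`BoundedResponseConverges`, stmt-9141), and its proper content is the continuity theorem. Pure real analysis over
landed identities; standard axioms; no definitions, no named facts.
-/

noncomputable section

open MeasureTheory Filter Topology Set

namespace Summit.AtomisticToContinuum.FouriersLaw.Theorems

open Literature.MathematicalPhysics.KineticTheory.HeatConduction
open Summit.AtomisticToContinuum.FouriersLaw.Theses

/-- **Sequence lemma.** A real sequence bounded in absolute value whose `EReal` image converges, converges in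
`ℝ`. [folklore] -/
theorem cml_exists_tendsto_of_ereal_tendsto_of_abs_le (D : ℕ → ℝ) {ℓ : EReal}
    (hℓ : Tendsto (fun N : ℕ => ((D N : ℝ) : EReal)) atTop (𝓝 ℓ))
    {B : ℝ} (hB : ∀ N, |D N| ≤ B) : ∃ L : ℝ, Tendsto D atTop (𝓝 L) := by
  have hℓ_le : ℓ ≤ ((B : ℝ) : EReal) :=
    le_of_tendsto' hℓ fun N => EReal.coe_le_coe_iff.2 ((le_abs_self _).trans (hB N))
  have hℓ_ge : ((-B : ℝ) : EReal) ≤ ℓ :=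
    ge_of_tendsto' hℓ fun N => EReal.coe_le_coe_iff.2 (abs_le.1 (hB N)).1
  have hℓ_top : ℓ ≠ ⊤ := ne_top_of_le_ne_top (EReal.coe_ne_top _) hℓ_le
  have hℓ_bot : ℓ ≠ ⊥ := ne_bot_of_le_ne_bot (EReal.coe_ne_bot _) hℓ_ge
  refine ⟨ℓ.toReal, ?_⟩
  have h : Tendsto (fun N : ℕ => ((D N : ℝ) : EReal)) atTop (𝓝 ((ℓ.toReal : ℝ) : EReal)) := by
    rwa [EReal.coe_toReal hℓ_top hℓ_bot]
  exact EReal.tendsto_coe.1 h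

/-- The bondless chains carry no current: for `N ≤ 1` every bond current of an oscillator chain vanishes, so the
total current of any measure is `0`. [folklore] -/
theorem cml_totalCurrent_eq_zero_of_lt_two (P : OscillatorChain) {N : ℕ} (hN : ¬ 2 ≤ N)
    (μ : Measure (PhaseSpace N)) : P.totalCurrent μ = 0 := by
  have hj : ∀ (i : Fin N) (x : PhaseSpace N), P.bondCurrent N i x = 0 := fun i x => by
    unfold OscillatorChain.bondCurrent
    refine Finset.sum_eq_zero fun j _ => ?_
    have hji : ¬ (j.val = i.val + 1) := by have := j.isLt; omega
    rw [if_neg hji]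
  unfold OscillatorChain.totalCurrent
  exact Finset.sum_eq_zero fun i _ => by simp only [hj, MeasureTheory.integral_zero]

/-- **The physical step, from the two items.** Given `EscapeNonOscillation` (12238) and `BoundedResponse` (10924):
for `pinnedChain ω₂ lam β ·` (all `> 0`), `T > 0`, every family `Φ` satisfying the crux's representing hypothesis
and every friction `γ > 0`, the scaled contact transforms `N·∫_(t>0) Φ_N(t)·2t/(γ²+t²)² dt` converge.
[cite: KunduDharNarayan2009, arXiv:0809.4543 p. 3] -/
theorem cml_scaledTransforms_tendsto
    (hE : BoundaryEscapeDeficit.EscapeNonOscillation) (hB : OddSectorIrreversibility.BoundedResponse)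
    {ω₂ lam β : ℝ} (hω : 0 < ω₂) (hl : 0 < lam) (hβ : 0 < β) {T : ℝ} (hT : 0 < T)
    (Φ : ℕ → ℝ → ℝ)
    (hΦ : ∀ N : ℕ, 2 ≤ N → Monotone (Φ N) ∧ (∀ s : ℝ, s ≤ 0 → Φ N s = 0) ∧ (∃ m : ℝ, ∀ s : ℝ, Φ N s ≤ m) ∧
      ∀ γ : ℝ, 0 < γ →
        (∀ (N' : ℕ) (T_L T_R : ℝ), 0 < T_L → 0 < T_R →
          ∀ μ ν : MeasureTheory.Measure (PhaseSpace N'),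
            (pinnedChain ω₂ lam β γ).IsSteadyState N' T_L T_R μ →
            (pinnedChain ω₂ lam β γ).IsSteadyState N' T_L T_R ν → μ = ν) →
        ∀ μ : (N' : ℕ) → ℝ → ℝ → MeasureTheory.Measure (PhaseSpace N'),
          (∀ (N' : ℕ) (T_L T_R : ℝ), 0 < T_L → 0 < T_R →
            (pinnedChain ω₂ lam β γ).IsSteadyState N' T_L T_R (μ N' T_L T_R)) →
          Filter.Tendsto (fun δ : ℝ =>
            (pinnedChain ω₂ lam β γ).totalCurrent (μ N (T + δ / 2) (T - δ / 2)) / δ) (nhdsWithin 0 {(0 : ℝ)}ᶜ)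
            (nhds (((N : ℝ) - 1) * γ * ∫ t in Set.Ioi (0 : ℝ), Φ N t * (2 * t / (γ ^ 2 + t ^ 2) ^ 2)))) :
    ∀ γ : ℝ, 0 < γ → ∃ L : ℝ,
      Tendsto (fun N : ℕ => (N : ℝ) * ∫ t in Set.Ioi (0 : ℝ), Φ N t * (2 * t / (γ ^ 2 + t ^ 2) ^ 2))
        atTop (𝓝 L) := by
  intro γ hγ
  have hU : ∀ (N : ℕ) (T_L T_R : ℝ), 0 < T_L → 0 < T_R → ∀ μ ν : Measure (PhaseSpace N),
      (pinnedChain ω₂ lam β γ).IsSteadyState N T_L T_R μ →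
        (pinnedChain ω₂ lam β γ).IsSteadyState N T_L T_R ν → μ = ν :=
    nessUnique_proof ω₂ lam β γ hω hl hβ hγ
  classical
  set μc : (N : ℕ) → ℝ → ℝ → Measure (PhaseSpace N) := fun N T_L T_R =>
    if h : 0 < T_L ∧ 0 < T_R then
      Classical.choose (pinnedChain_exists_isSteadyState hω hl hβ hγ N h.1 h.2) else 0 with hμc
  have hμc' : ∀ (N : ℕ) (T_L T_R : ℝ), 0 < T_L → 0 < T_R →
      (pinnedChain ω₂ lam β γ).IsSteadyState N T_L T_R (μc N T_L T_R) := by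
    intro N T_L T_R hL hR
    have h : 0 < T_L ∧ 0 < T_R := ⟨hL, hR⟩
    simp only [hμc, dif_pos h]
    exact Classical.choose_spec (pinnedChain_exists_isSteadyState hω hl hβ hγ N h.1 h.2)
  set I : ℕ → ℝ := fun N => ∫ t in Set.Ioi (0 : ℝ), Φ N t * (2 * t / (γ ^ 2 + t ^ 2) ^ 2) with hI
  set D : ℕ → ℝ := fun N => if 2 ≤ N then ((N : ℝ) - 1) * γ * I N else 0 with hDdef
  have hD2 : ∀ N : ℕ, 2 ≤ N → D N = ((N : ℝ) - 1) * γ * I N := fun N hN => by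
    simp only [hDdef, if_pos hN]
  have hresp : ∀ N : ℕ, Tendsto (fun δ : ℝ =>
      (pinnedChain ω₂ lam β γ).totalCurrent (μc N (T + δ / 2) (T - δ / 2)) / δ) (𝓝[≠] 0) (𝓝 (D N)) := by
    intro N
    by_cases hN : 2 ≤ N
    · rw [hD2 N hN]
      exact (hΦ N hN).2.2.2 γ hγ hU μc hμc'
    · have hD0 : D N = 0 := by simp only [hDdef, if_neg hN]
      rw [hD0]
      have e : (fun δ : ℝ =>
          (pinnedChain ω₂ lam β γ).totalCurrent (μc N (T + δ / 2) (T - δ / 2)) / δ) = fun _ => 0 := by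
        funext δ
        rw [cml_totalCurrent_eq_zero_of_lt_two _ hN, zero_div]
      rw [e]
      exact tendsto_const_nhds
  obtain ⟨Bd, hBd⟩ := hB ω₂ lam β γ hω hl hβ hγ hU μc hμc' T hT D hresp
  have hBd' : ∀ N : ℕ, |D N| ≤ Bd := fun N => hBd ⟨N, rfl⟩
  have hE' := hE ω₂ lam β γ hω hl hβ hγ T hT
  dsimp only at hE'
  obtain ⟨ℓ, hℓ⟩ := hE'
  have hDe : ∀ N : ℕ, 2 ≤ N → D N = ((N : ℝ) - 1) * γ * (1 - γ / T ^ 2 * ∫ u in Set.Ioi (0 : ℝ),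
      if h : 0 < N then ∫ z, ((z.2 ⟨0, h⟩) ^ 2 - T) * (∫ y, ((y.2 ⟨0, h⟩) ^ 2 - T)
        ∂((pinnedChain ω₂ lam β γ).transitionKernel N T T u.toNNReal z))
        ∂((pinnedChain ω₂ lam β γ).gibbsMeasure N T) else 0) := by
    intro N hN
    have hN0 : 0 < N := lt_of_lt_of_le Nat.two_pos hN
    rw [responseCoeff_eq_escapeDeficit hω hl hβ hγ hU μc hμc' hT hN0 (hresp N)]
    simp only [dif_pos hN0]
  have hℓD : Tendsto (fun N : ℕ => ((D N : ℝ) : EReal)) atTop (𝓝 ℓ) := by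
    refine hℓ.congr' ?_
    filter_upwards [eventually_ge_atTop 2] with N hN
    rw [hDe N hN]
  obtain ⟨Lr, hLr⟩ := cml_exists_tendsto_of_ereal_tendsto_of_abs_le D hℓD hBd'
  refine ⟨Lr * (1 * γ⁻¹), ?_⟩
  have hfrac : Tendsto (fun N : ℕ => (N : ℝ) / ((N : ℝ) + (-1 : ℝ))) atTop (𝓝 1) :=
    tendsto_natCast_div_add_atTop (-1 : ℝ)
  have h2 : Tendsto (fun N : ℕ => D N * ((N : ℝ) / ((N : ℝ) + (-1 : ℝ)) * γ⁻¹)) atTop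
      (𝓝 (Lr * (1 * γ⁻¹))) :=
    hLr.mul (hfrac.mul tendsto_const_nhds)
  refine h2.congr' ?_
  filter_upwards [eventually_ge_atTop 2] with N hN
  rw [hD2 N hN]
  have hN1 : (N : ℝ) + (-1 : ℝ) ≠ 0 := by
    have : (2 : ℝ) ≤ (N : ℝ) := by exact_mod_cast hN
    linarith
  have hγ0 : γ ≠ 0 := hγ.ne'
  have alg : ∀ J : ℝ,
      ((N : ℝ) - 1) * γ * J * ((N : ℝ) / ((N : ℝ) + (-1 : ℝ)) * γ⁻¹) = (N : ℝ) * J := by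
    intro J
    field_simp
    ring
  exact alg _

/-- **Transport by the continuity theorem.** The Stieltjes continuity theorem for the contact kernel (hypothesis
`hS`, the registered stub of the crux's lines) turns per-friction convergence of the scaled transforms
`N·∫ Φ_N k_γ` of a family that is monotone / vanishing on `(-∞,0]` / bounded from `N = 2` on into convergence of
`N·Φ_N(t)` at the continuity points of a monotone `M` (truncate the family to `0` below `N = 2`). [folklore] -/
theorem cml_tendsto_scaled_of_transforms
    (hS : ∀ F : ℕ → ℝ → ℝ,
      (∀ N : ℕ, Monotone (F N) ∧ (∀ s : ℝ, s ≤ 0 → F N s = 0) ∧ (∃ m : ℝ, ∀ s : ℝ, F N s ≤ m)) →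
      (∀ γ : ℝ, 0 < γ → ∃ L : ℝ,
        Filter.Tendsto (fun N : ℕ => ∫ t in Set.Ioi (0 : ℝ), F N t * (2 * t / (γ ^ 2 + t ^ 2) ^ 2))
          Filter.atTop (nhds L)) →
      ∃ M : ℝ → ℝ, Monotone M ∧ ∀ t : ℝ, 0 < t → ContinuousAt M t →
        Filter.Tendsto (fun N : ℕ => F N t) Filter.atTop (nhds (M t)))
    (Φ : ℕ → ℝ → ℝ)
    (hΦ : ∀ N : ℕ, 2 ≤ N → Monotone (Φ N) ∧ (∀ s : ℝ, s ≤ 0 → Φ N s = 0) ∧ (∃ m : ℝ, ∀ s : ℝ, Φ N s ≤ m))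
    (hC : ∀ γ : ℝ, 0 < γ → ∃ L : ℝ,
      Filter.Tendsto (fun N : ℕ => (N : ℝ) * ∫ t in Set.Ioi (0 : ℝ), Φ N t * (2 * t / (γ ^ 2 + t ^ 2) ^ 2))
        Filter.atTop (nhds L)) :
    ∃ M : ℝ → ℝ, Monotone M ∧ ∀ t : ℝ, 0 < t → ContinuousAt M t →
      Filter.Tendsto (fun N : ℕ => (N : ℝ) * Φ N t) Filter.atTop (nhds (M t)) := by
  classical
  -- the truncated rescaled family
  let F : ℕ → ℝ → ℝ := fun N t => if 2 ≤ N then (N : ℝ) * Φ N t else 0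
  have hF2 : ∀ N : ℕ, 2 ≤ N → ∀ t, F N t = (N : ℝ) * Φ N t := fun N hN t => if_pos hN
  have hF0 : ∀ N : ℕ, ¬ 2 ≤ N → ∀ t, F N t = 0 := fun N hN t => if_neg hN
  have h1 : ∀ N : ℕ, Monotone (F N) ∧ (∀ s : ℝ, s ≤ 0 → F N s = 0) ∧ (∃ m : ℝ, ∀ s : ℝ, F N s ≤ m) := by
    intro N
    by_cases hN : 2 ≤ N
    · obtain ⟨hmono, hzero, ⟨m, hm⟩⟩ := hΦ N hN
      have hN0 : (0 : ℝ) ≤ (N : ℝ) := Nat.cast_nonneg N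
      refine ⟨fun a b hab => ?_, fun s hs => ?_, ⟨(N : ℝ) * m, fun s => ?_⟩⟩
      · rw [hF2 N hN, hF2 N hN]
        exact mul_le_mul_of_nonneg_left (hmono hab) hN0
      · rw [hF2 N hN, hzero s hs, mul_zero]
      · rw [hF2 N hN]
        exact mul_le_mul_of_nonneg_left (hm s) hN0
    · refine ⟨fun a b _ => ?_, fun s _ => hF0 N hN s, ⟨0, fun s => ?_⟩⟩
      · rw [hF0 N hN, hF0 N hN]
      · rw [hF0 N hN]
  have h2 : ∀ γ : ℝ, 0 < γ → ∃ L : ℝ, Filter.Tendsto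
      (fun N : ℕ => ∫ t in Set.Ioi (0 : ℝ), F N t * (2 * t / (γ ^ 2 + t ^ 2) ^ 2))
      Filter.atTop (nhds L) := by
    intro γ hγ
    obtain ⟨L, hL⟩ := hC γ hγ
    refine ⟨L, hL.congr' ?_⟩
    filter_upwards [Filter.eventually_ge_atTop 2] with N hN
    have hfun : (fun t : ℝ => F N t * (2 * t / (γ ^ 2 + t ^ 2) ^ 2)) =
        fun t : ℝ => (N : ℝ) * (Φ N t * (2 * t / (γ ^ 2 + t ^ 2) ^ 2)) := by
      funext t
      rw [hF2 N hN, mul_assoc]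
    rw [hfun, MeasureTheory.integral_const_mul]
  obtain ⟨M, hMmono, hM⟩ := hS F h1 h2
  refine ⟨M, hMmono, fun t ht hct => ?_⟩
  refine (hM t ht hct).congr' ?_
  filter_upwards [Filter.eventually_ge_atTop 2] with N hN
  exact hF2 N hN t

/-- **SPLIT GLUE.** `ContactMeasureLimit ⇐ StieltjesContinuity ∧ EscapeNonOscillation ∧ BoundedResponse`: the
Stieltjes continuity theorem for the contact kernel (first hypothesis, pure real analysis), the `EReal` limit of
the escape deficit (item stmt-AtomisticToContinuum-12238) and bounded response (item stmt-AtomisticToContinuum-10924)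
imply the crux (M) of route `ContactStieltjesMeasure` (stmt-AtomisticToContinuum-15250).
[cite: KunduDharNarayan2009, arXiv:0809.4543 p. 3] -/
theorem contactMeasureLimit_of_subs
    (hS : ∀ F : ℕ → ℝ → ℝ,
      (∀ N : ℕ, Monotone (F N) ∧ (∀ s : ℝ, s ≤ 0 → F N s = 0) ∧ (∃ m : ℝ, ∀ s : ℝ, F N s ≤ m)) →
      (∀ γ : ℝ, 0 < γ → ∃ L : ℝ,
        Filter.Tendsto (fun N : ℕ => ∫ t in Set.Ioi (0 : ℝ), F N t * (2 * t / (γ ^ 2 + t ^ 2) ^ 2))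
          Filter.atTop (nhds L)) →
      ∃ M : ℝ → ℝ, Monotone M ∧ ∀ t : ℝ, 0 < t → ContinuousAt M t →
        Filter.Tendsto (fun N : ℕ => F N t) Filter.atTop (nhds (M t)))
    (hE : BoundaryEscapeDeficit.EscapeNonOscillation) (hB : OddSectorIrreversibility.BoundedResponse) :
    ContactStieltjesMeasure.ContactMeasureLimit := by
  intro ω₂ lam β hω hl hβ T hT Φ hΦ
  exact cml_tendsto_scaled_of_transforms hS Φ (fun N hN => ⟨(hΦ N hN).1, (hΦ N hN).2.1, (hΦ N hN).2.2.1⟩)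
    (cml_scaledTransforms_tendsto hE hB hω hl hβ hT Φ hΦ)

/-! ## Exactness: granted the route's K2 and (U), the crux gives the two items back -/

/-- Majorant for the contact kernel: `(1+t)·2t/(γ²+t²)² ≤ (3 + 2/γ² + 1/γ⁴)·(1+t²)⁻¹` on `t ≥ 0` (the route's
`closes` estimate). [folklore] -/
theorem cml_kernel_majorant {γ : ℝ} (hγ : 0 < γ) (t : ℝ) (_ht : 0 ≤ t) :
    (1 + t) * (2 * t / (γ ^ 2 + t ^ 2) ^ 2) ≤ (3 + 2 / γ ^ 2 + 1 / γ ^ 4) * (1 + t ^ 2)⁻¹ := by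
  have hγ2 : 0 < γ ^ 2 := by positivity
  have hden : 0 < (γ ^ 2 + t ^ 2) ^ 2 := by positivity
  have h1 : 0 < 1 + t ^ 2 := by positivity
  have hg4 : 0 < γ ^ 4 := by positivity
  rw [mul_div_assoc', div_le_iff₀ hden, mul_assoc, inv_mul_eq_div, mul_div_assoc', le_div_iff₀ h1]
  have hK : (3 + 2 / γ ^ 2 + 1 / γ ^ 4) = (3 * γ ^ 4 + 2 * γ ^ 2 + 1) / γ ^ 4 := by
    field_simp
  rw [hK, div_mul_eq_mul_div, le_div_iff₀ hg4]
  have e1 : 2 * t ≤ 1 + t ^ 2 := by nlinarith [sq_nonneg (t - 1)]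
  have e2 : 2 * t ^ 3 ≤ t ^ 2 + t ^ 4 := by nlinarith [sq_nonneg (t - 1), sq_nonneg t]
  have lhs : (1 + t) * (2 * t) * (1 + t ^ 2) ≤ 3 * t ^ 4 + 4 * t ^ 2 + 1 := by nlinarith [e1, e2]
  have rhs : (3 * t ^ 4 + 4 * t ^ 2 + 1) * γ ^ 4 ≤ (3 * γ ^ 4 + 2 * γ ^ 2 + 1) * (γ ^ 2 + t ^ 2) ^ 2 := by
    nlinarith [sq_nonneg (γ * t), sq_nonneg γ, sq_nonneg t, mul_nonneg hγ2.le (sq_nonneg t),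
      mul_nonneg (mul_nonneg hγ2.le hγ2.le) (sq_nonneg t), pow_nonneg (sq_nonneg t) 2,
      mul_nonneg hγ2.le (pow_nonneg (sq_nonneg t) 2)]
  calc (1 + t) * (2 * t) * (1 + t ^ 2) * γ ^ 4 ≤ (3 * t ^ 4 + 4 * t ^ 2 + 1) * γ ^ 4 :=
        mul_le_mul_of_nonneg_right lhs hg4.le
    _ ≤ (3 * γ ^ 4 + 2 * γ ^ 2 + 1) * (γ ^ 2 + t ^ 2) ^ 2 := rhs

/-- **Dominated convergence on the route's data.** Given a family `Φ` (monotone, vanishing on `(-∞,0]` from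
`N = 2` on), the upper density `N·Φ_N(t) ≤ C(1+t)` (`N ≥ N₀`, `t > 0`) and convergence `N·Φ_N(t) → M(t)` at the
continuity points `t > 0` of a monotone `M`, the scaled transforms converge:
`∫_(t>0) N·Φ_N(t)·k_γ(t) dt → ∫_(t>0) M·k_γ` for every `γ > 0`. [folklore] -/
theorem cml_tendsto_scaledTransform_of_density_of_limit {γ : ℝ} (hγ : 0 < γ) (Φ : ℕ → ℝ → ℝ)
    (hΦ : ∀ N : ℕ, 2 ≤ N → Monotone (Φ N) ∧ (∀ s : ℝ, s ≤ 0 → Φ N s = 0))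
    {C : ℝ} {N₀ : ℕ} (hC : ∀ N : ℕ, N₀ ≤ N → ∀ t : ℝ, 0 < t → (N : ℝ) * Φ N t ≤ C * (1 + t))
    {M : ℝ → ℝ} (hMmono : Monotone M)
    (hM : ∀ t : ℝ, 0 < t → ContinuousAt M t → Tendsto (fun N : ℕ => (N : ℝ) * Φ N t) atTop (𝓝 (M t))) :
    Tendsto (fun N : ℕ => ∫ t in Set.Ioi (0 : ℝ), ((N : ℝ) * Φ N t) * (2 * t / (γ ^ 2 + t ^ 2) ^ 2)) atTop
      (𝓝 (∫ t in Set.Ioi (0 : ℝ), M t * (2 * t / (γ ^ 2 + t ^ 2) ^ 2))) := by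
  have hγ2 : 0 < γ ^ 2 := by positivity
  have hden : ∀ t : ℝ, 0 < (γ ^ 2 + t ^ 2) ^ 2 := fun t => by positivity
  have hw_nonneg : ∀ t : ℝ, 0 ≤ t → 0 ≤ 2 * t / (γ ^ 2 + t ^ 2) ^ 2 := fun t ht =>
    div_nonneg (by linarith) (hden t).le
  have hw_cont : Continuous fun t : ℝ => 2 * t / (γ ^ 2 + t ^ 2) ^ 2 := by
    refine Continuous.div (by fun_prop) (by fun_prop) fun t => (hden t).ne'
  have hΦ_nonneg : ∀ N : ℕ, 2 ≤ N → ∀ t : ℝ, 0 ≤ t → 0 ≤ Φ N t := by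
    intro N hN t ht
    have h0 : Φ N 0 = 0 := (hΦ N hN).2 0 le_rfl
    simpa [h0] using (hΦ N hN).1 ht
  have hC_nonneg : 0 ≤ C := by
    have h := hC (max N₀ 2) (le_max_left _ _) 1 one_pos
    have h' : 0 ≤ ((max N₀ 2 : ℕ) : ℝ) * Φ (max N₀ 2) 1 :=
      mul_nonneg (Nat.cast_nonneg _) (hΦ_nonneg _ (le_max_right _ _) 1 zero_le_one)
    linarith
  refine MeasureTheory.tendsto_integral_filter_of_dominated_convergence
    (fun t => C * (1 + t) * (2 * t / (γ ^ 2 + t ^ 2) ^ 2)) ?_ ?_ ?_ ?_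
  · refine Filter.eventually_atTop.2 ⟨2, fun N hN => ?_⟩
    exact ((measurable_const.mul (hΦ N hN).1.measurable).mul hw_cont.measurable).aestronglyMeasurable
  · refine Filter.eventually_atTop.2 ⟨max N₀ 2, fun N hN => ?_⟩
    refine (MeasureTheory.ae_restrict_iff' measurableSet_Ioi).2 (Filter.Eventually.of_forall fun t ht => ?_)
    have ht : 0 < t := ht
    have h1 : 0 ≤ (N : ℝ) * Φ N t :=
      mul_nonneg (Nat.cast_nonneg _) (hΦ_nonneg N (le_trans (le_max_right _ _) hN) t ht.le)
    rw [Real.norm_eq_abs, abs_of_nonneg (mul_nonneg h1 (hw_nonneg t ht.le))]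
    exact mul_le_mul_of_nonneg_right (hC N (le_trans (le_max_left _ _) hN) t ht) (hw_nonneg t ht.le)
  · have hKint : MeasureTheory.Integrable (fun t : ℝ => (C * (3 + 2 / γ ^ 2 + 1 / γ ^ 4)) * (1 + t ^ 2)⁻¹)
        (MeasureTheory.volume.restrict (Set.Ioi (0 : ℝ))) :=
      (integrable_inv_one_add_sq.const_mul _).integrableOn
    refine hKint.mono' ?_ ?_
    · exact (Continuous.mul (by fun_prop) hw_cont).aestronglyMeasurable
    · refine (MeasureTheory.ae_restrict_iff' measurableSet_Ioi).2 (Filter.Eventually.of_forall fun t ht => ?_)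
      have ht : 0 < t := ht
      have hnn : 0 ≤ C * (1 + t) * (2 * t / (γ ^ 2 + t ^ 2) ^ 2) :=
        mul_nonneg (mul_nonneg hC_nonneg (by linarith)) (hw_nonneg t ht.le)
      rw [Real.norm_eq_abs, abs_of_nonneg hnn, mul_assoc, mul_assoc]
      exact mul_le_mul_of_nonneg_left (cml_kernel_majorant hγ t ht.le) hC_nonneg
  · have hS : MeasureTheory.volume {t : ℝ | ¬ContinuousAt M t} = 0 :=
      hMmono.countable_not_continuousAt.measure_zero _
    have hae : ∀ᵐ t ∂(MeasureTheory.volume.restrict (Set.Ioi (0 : ℝ))), ContinuousAt M t := by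
      refine MeasureTheory.ae_restrict_of_ae ?_
      rw [MeasureTheory.ae_iff]
      simpa using hS
    filter_upwards [hae, MeasureTheory.ae_restrict_mem measurableSet_Ioi] with t hcont ht
    exact (hM t ht hcont).mul_const _

/-- **Exactness, oscillation half.** Granted the route's own K2 (`StieltjesRepresentation`) and (U)
(`ContactUpperDensity`), the crux (M) implies `EscapeNonOscillation` (12238) at EVERY friction: the response
coefficients `D_N(γ) = (N−1)γ∫Φ_N k_γ` converge by dominated convergence (the `closes` computation), and they ARE
the escape-deficit sequence `e_N` (`responseCoeff_eq_escapeDeficit`). [cite: KunduDharNarayan2009, arXiv:0809.4543 p. 3] -/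
theorem escapeNonOscillation_of_contactStieltjes
    (hRep : ContactStieltjesMeasure.StieltjesRepresentation) (hUD : ContactStieltjesMeasure.ContactUpperDensity)
    (hLim : ContactStieltjesMeasure.ContactMeasureLimit) : BoundaryEscapeDeficit.EscapeNonOscillation := by
  intro ω₂ lam β γ hω hl hβ hγ T hT
  dsimp only
  have hU : ∀ (N : ℕ) (T_L T_R : ℝ), 0 < T_L → 0 < T_R → ∀ μ ν : Measure (PhaseSpace N),
      (pinnedChain ω₂ lam β γ).IsSteadyState N T_L T_R μ →
        (pinnedChain ω₂ lam β γ).IsSteadyState N T_L T_R ν → μ = ν :=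
    nessUnique_proof ω₂ lam β γ hω hl hβ hγ
  classical
  set μc : (N : ℕ) → ℝ → ℝ → Measure (PhaseSpace N) := fun N T_L T_R =>
    if h : 0 < T_L ∧ 0 < T_R then
      Classical.choose (pinnedChain_exists_isSteadyState hω hl hβ hγ N h.1 h.2) else 0 with hμc
  have hμc' : ∀ (N : ℕ) (T_L T_R : ℝ), 0 < T_L → 0 < T_R →
      (pinnedChain ω₂ lam β γ).IsSteadyState N T_L T_R (μc N T_L T_R) := by
    intro N T_L T_R hL hR
    have h : 0 < T_L ∧ 0 < T_R := ⟨hL, hR⟩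
    simp only [hμc, dif_pos h]
    exact Classical.choose_spec (pinnedChain_exists_isSteadyState hω hl hβ hγ N h.1 h.2)
  obtain ⟨Φ, hΦ⟩ := hRep ω₂ lam β hω hl.le hβ.le T hT
  obtain ⟨C, N₀, hC⟩ := hUD ω₂ lam β hω hl hβ T hT Φ hΦ
  obtain ⟨M, hMmono, hM⟩ := hLim ω₂ lam β hω hl hβ T hT Φ hΦ
  -- convergence of the scaled transforms by dominated convergence
  set L : ℝ := ∫ t in Set.Ioi (0 : ℝ), M t * (2 * t / (γ ^ 2 + t ^ 2) ^ 2) with hL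
  have hDCT := cml_tendsto_scaledTransform_of_density_of_limit hγ Φ
    (fun N hN => ⟨(hΦ N hN).1, (hΦ N hN).2.1⟩) hC hMmono hM
  -- the response coefficients along `μc` for `N ≥ 2`
  set I : ℕ → ℝ := fun N => ∫ t in Set.Ioi (0 : ℝ), Φ N t * (2 * t / (γ ^ 2 + t ^ 2) ^ 2) with hI
  have hresp : ∀ N : ℕ, 2 ≤ N → Tendsto (fun δ : ℝ =>
      (pinnedChain ω₂ lam β γ).totalCurrent (μc N (T + δ / 2) (T - δ / 2)) / δ) (𝓝[≠] 0)
      (𝓝 (((N : ℝ) - 1) * γ * I N)) := fun N hN => (hΦ N hN).2.2.2 γ hγ hU μc hμc'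
  have hDe : ∀ N : ℕ, 2 ≤ N → ((N : ℝ) - 1) * γ * I N =
      ((N : ℝ) - 1) * γ * (1 - γ / T ^ 2 * ∫ u in Set.Ioi (0 : ℝ),
      if h : 0 < N then ∫ z, ((z.2 ⟨0, h⟩) ^ 2 - T) * (∫ y, ((y.2 ⟨0, h⟩) ^ 2 - T)
        ∂((pinnedChain ω₂ lam β γ).transitionKernel N T T u.toNNReal z))
        ∂((pinnedChain ω₂ lam β γ).gibbsMeasure N T) else 0) := by
    intro N hN
    have hN0 : 0 < N := lt_of_lt_of_le Nat.two_pos hN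
    rw [responseCoeff_eq_escapeDeficit hω hl hβ hγ hU μc hμc' hT hN0 (hresp N hN)]
    simp only [dif_pos hN0]
  -- `(N-1)γ I_N = γ · ((N-1)/N) · ∫ (N Φ_N) k_γ → γ · L`
  have hfrac : Filter.Tendsto (fun N : ℕ => ((N : ℝ) - 1) / N) Filter.atTop (nhds 1) := by
    have h : Filter.Tendsto (fun N : ℕ => (1 : ℝ) - 1 / (N : ℝ)) Filter.atTop (nhds (1 - 0)) :=
      tendsto_const_nhds.sub tendsto_one_div_atTop_nhds_zero_nat
    rw [sub_zero] at h
    refine h.congr' ?_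
    filter_upwards [Filter.eventually_gt_atTop 0] with N hN
    have hN' : (N : ℝ) ≠ 0 := by exact_mod_cast hN.ne'
    field_simp
  have hDlim : Filter.Tendsto (fun N : ℕ => ((N : ℝ) - 1) * γ * I N) Filter.atTop (nhds (γ * (1 * L))) := by
    have h := (tendsto_const_nhds (x := γ)).mul (hfrac.mul hDCT)
    refine h.congr' ?_
    filter_upwards [Filter.eventually_ge_atTop 2] with N hN
    have hN' : (N : ℝ) ≠ 0 := by
      have : (2 : ℝ) ≤ N := by exact_mod_cast hN
      linarith
    have hfun : (fun t : ℝ => (N : ℝ) * Φ N t * (2 * t / (γ ^ 2 + t ^ 2) ^ 2)) =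
        fun t : ℝ => (N : ℝ) * (Φ N t * (2 * t / (γ ^ 2 + t ^ 2) ^ 2)) := by
      funext t; ring
    rw [hfun, MeasureTheory.integral_const_mul]
    have alg : ∀ J : ℝ, γ * (((N : ℝ) - 1) / N * ((N : ℝ) * J)) = ((N : ℝ) - 1) * γ * J := by
      intro J
      field_simp
    exact alg _
  refine ⟨((γ * (1 * L) : ℝ) : EReal), ?_⟩
  refine EReal.tendsto_coe.2 (hDlim.congr' ?_)
  filter_upwards [Filter.eventually_ge_atTop 2] with N hN
  exact hDe N hN

/-- **Exactness, boundedness half.** The route's K2 (`StieltjesRepresentation`) and (U) (`ContactUpperDensity`)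
supply the sibling item `BoundedResponse` (10924) at every friction: along any steady-state family the response
coefficients are `(N−1)γ∫Φ_N k_γ` (`N ≥ 2`, uniqueness of limits), and
`0 ≤ ∫Φ_N k_γ ≤ (C/N)·(3 + 2/γ² + 1/γ⁴)·∫(1+t²)⁻¹`. [folklore] -/
theorem boundedResponse_of_contactStieltjes
    (hRep : ContactStieltjesMeasure.StieltjesRepresentation) (hUD : ContactStieltjesMeasure.ContactUpperDensity) :
    OddSectorIrreversibility.BoundedResponse := by
  intro ω₂ lam β γ hω hl hβ hγ hU μ hμ T hT D hD
  obtain ⟨Φ, hΦ⟩ := hRep ω₂ lam β hω hl.le hβ.le T hT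
  obtain ⟨C, N₀, hC⟩ := hUD ω₂ lam β hω hl hβ T hT Φ hΦ
  have hγ2 : 0 < γ ^ 2 := by positivity
  have hden : ∀ t : ℝ, 0 < (γ ^ 2 + t ^ 2) ^ 2 := fun t => by positivity
  have hw_nonneg : ∀ t : ℝ, 0 ≤ t → 0 ≤ 2 * t / (γ ^ 2 + t ^ 2) ^ 2 := fun t ht =>
    div_nonneg (by linarith) (hden t).le
  have hw_cont : Continuous fun t : ℝ => 2 * t / (γ ^ 2 + t ^ 2) ^ 2 := by
    refine Continuous.div (by fun_prop) (by fun_prop) fun t => (hden t).ne'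
  have hΦ_nonneg : ∀ N : ℕ, 2 ≤ N → ∀ t : ℝ, 0 ≤ t → 0 ≤ Φ N t := by
    intro N hN t ht
    have h0 : Φ N 0 = 0 := (hΦ N hN).2.1 0 le_rfl
    simpa [h0] using (hΦ N hN).1 ht
  have hC_nonneg : 0 ≤ C := by
    have h := hC (max N₀ 2) (le_max_left _ _) 1 one_pos
    have h' : 0 ≤ ((max N₀ 2 : ℕ) : ℝ) * Φ (max N₀ 2) 1 :=
      mul_nonneg (Nat.cast_nonneg _) (hΦ_nonneg _ (le_max_right _ _) 1 zero_le_one)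
    linarith
  -- the integrable majorant `K·(1+t²)⁻¹` and `W := ∫ (1+t) k_γ`
  set Kc : ℝ := 3 + 2 / γ ^ 2 + 1 / γ ^ 4 with hKc
  have hKc_nonneg : 0 ≤ Kc := by positivity
  have hmajInt : MeasureTheory.Integrable (fun t : ℝ => Kc * (1 + t ^ 2)⁻¹)
      (MeasureTheory.volume.restrict (Set.Ioi (0 : ℝ))) :=
    (integrable_inv_one_add_sq.const_mul _).integrableOn
  set W : ℝ := ∫ t in Set.Ioi (0 : ℝ), Kc * (1 + t ^ 2)⁻¹ with hW
  have hW_nonneg : 0 ≤ W :=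
    MeasureTheory.setIntegral_nonneg measurableSet_Ioi fun t _ => mul_nonneg hKc_nonneg (by positivity)
  -- `D N = (N-1)γ∫Φ_N k_γ` for `N ≥ 2`
  have hDe : ∀ N : ℕ, 2 ≤ N →
      D N = ((N : ℝ) - 1) * γ * ∫ t in Set.Ioi (0 : ℝ), Φ N t * (2 * t / (γ ^ 2 + t ^ 2) ^ 2) :=
    fun N hN => tendsto_nhds_unique (hD N) ((hΦ N hN).2.2.2 γ hγ hU μ hμ)
  -- the bound for `N ≥ max N₀ 2`
  have hbound : ∀ N : ℕ, max N₀ 2 ≤ N → |D N| ≤ γ * (C * W) := by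
    intro N hN
    have hN2 : 2 ≤ N := le_trans (le_max_right _ _) hN
    have hN0' : N₀ ≤ N := le_trans (le_max_left _ _) hN
    have hNpos : (0 : ℝ) < N := by
      have : (2 : ℝ) ≤ N := by exact_mod_cast hN2
      linarith
    have hint_nonneg : 0 ≤ ∫ t in Set.Ioi (0 : ℝ), Φ N t * (2 * t / (γ ^ 2 + t ^ 2) ^ 2) :=
      MeasureTheory.setIntegral_nonneg measurableSet_Ioi fun t ht =>
        mul_nonneg (hΦ_nonneg N hN2 t (le_of_lt ht)) (hw_nonneg t (le_of_lt ht))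
    have hint_le : ∫ t in Set.Ioi (0 : ℝ), Φ N t * (2 * t / (γ ^ 2 + t ^ 2) ^ 2) ≤
        ∫ t in Set.Ioi (0 : ℝ), (C / N) * (Kc * (1 + t ^ 2)⁻¹) := by
      refine MeasureTheory.integral_mono_of_nonneg ?_ (hmajInt.const_mul _) ?_
      · refine (MeasureTheory.ae_restrict_iff' measurableSet_Ioi).2 (Filter.Eventually.of_forall fun t ht => ?_)
        exact mul_nonneg (hΦ_nonneg N hN2 t (le_of_lt ht)) (hw_nonneg t (le_of_lt ht))
      · refine (MeasureTheory.ae_restrict_iff' measurableSet_Ioi).2 (Filter.Eventually.of_forall fun t ht => ?_)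
        have ht : 0 < t := ht
        have hΦle : Φ N t ≤ C / N * (1 + t) := by
          rw [div_mul_eq_mul_div, le_div_iff₀ hNpos, mul_comm]
          exact hC N hN0' t ht
        calc Φ N t * (2 * t / (γ ^ 2 + t ^ 2) ^ 2)
            ≤ C / N * (1 + t) * (2 * t / (γ ^ 2 + t ^ 2) ^ 2) :=
              mul_le_mul_of_nonneg_right hΦle (hw_nonneg t ht.le)
          _ = C / N * ((1 + t) * (2 * t / (γ ^ 2 + t ^ 2) ^ 2)) := by ring
          _ ≤ C / N * (Kc * (1 + t ^ 2)⁻¹) :=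
              mul_le_mul_of_nonneg_left (cml_kernel_majorant hγ t ht.le)
                (div_nonneg hC_nonneg hNpos.le)
    rw [MeasureTheory.integral_const_mul] at hint_le
    have hN1 : (0 : ℝ) ≤ (N : ℝ) - 1 := by
      have : (2 : ℝ) ≤ N := by exact_mod_cast hN2
      linarith
    rw [hDe N hN2, abs_of_nonneg (mul_nonneg (mul_nonneg hN1 hγ.le) hint_nonneg)]
    have hfracle : ((N : ℝ) - 1) * (C / N) ≤ C := by
      rw [mul_div_assoc', div_le_iff₀ hNpos]
      nlinarith
    calc ((N : ℝ) - 1) * γ * ∫ t in Set.Ioi (0 : ℝ), Φ N t * (2 * t / (γ ^ 2 + t ^ 2) ^ 2)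
        ≤ ((N : ℝ) - 1) * γ * (C / N * W) :=
          mul_le_mul_of_nonneg_left hint_le (mul_nonneg hN1 hγ.le)
      _ = γ * (((N : ℝ) - 1) * (C / N) * W) := by ring
      _ ≤ γ * (C * W) := mul_le_mul_of_nonneg_left (mul_le_mul_of_nonneg_right hfracle hW_nonneg) hγ.le
  -- eventually bounded ⇒ bounded range
  have hbu : Filter.IsBoundedUnder (· ≤ ·) Filter.cofinite (fun N : ℕ => |D N|) := by
    rw [Nat.cofinite_eq_atTop]
    exact ⟨γ * (C * W), Filter.eventually_atTop.2 ⟨max N₀ 2, hbound⟩⟩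
  exact hbu.bddAbove_range_of_cofinite

end Summit.AtomisticToContinuum.FouriersLaw.Theorems

end
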